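import Literature.AlgebraicGeometry.HodgeTheory.GysinKernelSplit
import Literature.AlgebraicGeometry.Resolution.MarkedIdeals
import Summits.HodgeConjecture.HodgeConjecture.Theorems.LimitExtensionMiddleDivisorSupportSufficesSNCPrinciple
import HarnessLib
import Literature.AlgebraicGeometry.HodgeTheory.GysinKernelSNC

/-!
# Route LimitExtension · `MiddleDivisorSupportSuffices` (stmt-HodgeConjecture-10865):
# the snc case of Deligne's Prop. 8.2.7 as the item's (and `DivisorInduction`'s) single Hodge-theoretic input

`…SNCPrinciple.lean` proves the item from the pencil crux `PencilReduction`
(stmt-HodgeConjecture-1083) and the snc principle of two types, spelled there as an inline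
hypothesis `hS`. This file names that hypothesis as what it is in print — the case of Deligne,
*Hodge III*, Prop. 8.2.7 in which `X̃ → X` is the normalisation `⊔ V(Dᵢ) → ⋃ V(Dᵢ)` of a simple
normal crossings divisor in a smooth projective `Y` (equivalently the "principle of two types" of
Deligne–Griffiths–Morgan–Sullivan 1975 §5–§6 and Griffiths–Schmid 1975 §4 for varieties with normal
crossings) — a named fact strictly weaker than the tree's
`Literature.AlgebraicGeometry.HodgeTheory.Deligne1974_ker_pullback_eq_ker_pullback_resolution`
(arbitrary finite families of morphisms, singular unions), in the same Čech rendering on the tree's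
carriers; and records the two closing terms through it.

## References

* [DeligneHodgeIII1974] P. Deligne, Théorie de Hodge III, Publ. Math. IHÉS 44 (1974), Prop. 8.2.7
  (p. 40; NUMDAM PDF p. 37).
* [DeligneGriffithsMorganSullivan1975] P. Deligne, P. Griffiths, J. Morgan, D. Sullivan, Real
  homotopy theory of Kähler manifolds, Invent. Math. 29 (1975), §5 Lemma 5.11, §6.
* [GriffithsSchmid1975] P. Griffiths, W. Schmid, Recent developments in Hodge theory, in: Discrete
  subgroups of Lie groups (Bombay 1973), OUP 1975, §4.
-/

-- `Summit.HodgeConjecture.HodgeConjecture.Theorems` is the mandated namespace (single-conjunct summit: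
-- Sub = Summit), which `linter.dupNamespace` flags; off tree-wide in the lakefile, restated here so
-- stand-alone elaboration is warning-free too.
set_option linter.dupNamespace false

noncomputable section

namespace Summit.HodgeConjecture.HodgeConjecture.Theorems

/-- **`DivisorInduction` (stmt-HodgeConjecture-1082, route decl) from the snc case of Prop. 8.2.7
alone** (`divisorInduction_of_snc827`). CONDITIONAL on that named fact.
[cite: DeligneHodgeIII1974, Prop. 8.2.7 and Cor. 8.2.8] -/
theorem divisorInduction_of_deligne827snc
    (h : Literature.AlgebraicGeometry.HodgeTheory.Deligne1974_ker_pullback_eq_ker_pullback_snc) :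
    Summit.HodgeConjecture.HodgeConjecture.Theses.LimitExtension.DivisorInduction :=
  divisorInduction_of_snc827 h

/-- **`MiddleDivisorSupportSuffices` (stmt-HodgeConjecture-10865) from the snc case of
Prop. 8.2.7 and the pencil crux `PencilReduction` (stmt-HodgeConjecture-1083)**
(`middleDivisorSupportSuffices_of_snc827`). CONDITIONAL on that named fact and on the crux; the
closing term once both are theorems:
`middleDivisorSupportSuffices_of_deligne827snc_of_pencilReduction <fact>_holds <1083 theorem>`.
[cite: DeligneHodgeIII1974, Prop. 8.2.7] [cite: Thomas2005Nodes, Prop. 2 (proof)] -/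
theorem middleDivisorSupportSuffices_of_deligne827snc_of_pencilReduction
    (h : Literature.AlgebraicGeometry.HodgeTheory.Deligne1974_ker_pullback_eq_ker_pullback_snc)
    (hPen : Summit.HodgeConjecture.HodgeConjecture.Theses.LimitExtension.PencilReduction) :
    Summit.HodgeConjecture.HodgeConjecture.Theses.LimitExtension.MiddleDivisorSupportSuffices :=
  middleDivisorSupportSuffices_of_snc827 h hPen

end Summit.HodgeConjecture.HodgeConjecture.Theorems

end
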